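import Summits.ResolutionOfSingularities.ResolutionOfSingularities.Theses.CleanCovers
import Summits.ResolutionOfSingularities.ResolutionOfSingularities.Theorems.WeightedInvariantWeightedThesisProjectiveIntegralSuffices
import Literature.AlgebraicGeometry.Resolution.KedlayaEtaleCoversProofs
import Literature.AlgebraicGeometry.Resolution.NonReducedNoResolution
import Literature.AlgebraicGeometry.Resolution.AbsoluteIntegralClosureNoResolution
import Literature.AlgebraicGeometry.Motives.VarietiesProperProofs

/-!
# Disproof of `KedlayaReduction` — findings: NOT REFUTABLE, the crux is PROVED

Standing disprover's work file for crux `CleanCovers.KedlayaReduction`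
(stmt-ResolutionOfSingularities-15241, route `ResolutionOfSingularities/CleanCovers`, rank 3):

  `KedlayaReduction := ∀ p prime, CoverResolutionAt p → PerfectResolutionAt p`

(`CoverResolutionAt p` = the body of the rank-2 crux `CoverResolution` at `p`: every integral `X`
finite surjective over `ℙⁿ_k`, `k` perfect of characteristic `p`, étale over the chart `D₊(xₙ)`, has a
resolution; `PerfectResolutionAt p` = resolution of every reduced separated finite-type scheme over
every perfect field of characteristic `p` = verbatim the hypothesis of `DescentPerfectToAll` at `p`).

## Findings (cycle 1, 2026-08-17)

* **§1 STATUS — PROVED, hence irrefutable.** `KedlayaReduction` is an 8-line sorry-free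
  consequence (axioms `propext, Classical.choice, Quot.sound`; checked in this seat's `W.lean`,
  attached to the item as evidence `KedlayaReductionHolds.lean`; recorded below pointwise in `p` as
  `perfectResolutionAt_of_coverResolutionAt`) of two PROVED tree theorems: the projective reduction
  `Theorems.WeightedThesis.ProjectiveIntegralSuffices.stub_projectiveIntegralSuffices`
  (components + Chow + projective closure) and Kedlaya 2005 Thm 1 in the tree's specialised form
  `Literature.AlgebraicGeometry.Resolution.Kedlaya2004_finite_etale_off_hyperplane_holds`
  (`KedlayaEtaleCoversProofs.lean`, landed 2026-08-17). No normalisation step is needed (a closed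
  subscheme of `ℙᴺ_k` is finite over `ℙᴺ_k`). A PROVER should land the evidence file as
  `Theorems/CleanCoversKedlayaReduction.lean` and close the item `proved`.
  Consequently `not_not_kedlayaReduction`: every disproof attempt is doomed; the rest of this file
  records what the attempts teach about the hypotheses.
* **§1 bis — the crux is an EQUIVALENCE.** `coverResolutionAt_iff_perfectResolutionAt`:
  for every prime `p`, `CoverResolutionAt p ↔ PerfectResolutionAt p` (→ is the crux, ← is the
  trivial embedding: an integral scheme finite over `ℙⁿ_k` is reduced, separated, of finite type).
  Hence `CoverResolution ↔ ∀ p prime, PerfectResolutionAt p` (`coverResolution_iff_perfect`): after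
  this crux closes, the route's open content is exactly `CoverResolution` (= the summit over perfect
  fields, Kedlaya normal form) and `DescentPerfectToAll`.
* **§2 LOAD-BEARING ANALYSIS** (drop one hypothesis at a time). Because the antecedent
  `CoverResolutionAt p` is itself OPEN (equivalent to resolution over perfect fields in char `p`,
  all dimensions), NO hypothesis-dropped variant of this crux is refutable OUTRIGHT today; each is
  pinned to a named open statement instead:
  - (H0) drop the antecedent: `KedlayaReductionWithoutCover ↔ CoverResolution` (crux #2, open in
    dim ≥ 4) — `kedlayaReductionWithoutCover_iff`.
  - (H1) drop `IsReduced X`: the conclusion is then FALSE at every prime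
    (`not_perfectResolutionWithoutIsReducedAt`, witness `Spec 𝔽_p[ε]`, tree
    `not_hasResolution_spec_dualNumber`), so `KedlayaReductionWithoutIsReduced ↔ ∀ p prime,
    ¬ CoverResolutionAt p` (`kedlayaReductionWithoutIsReduced_iff`): dropping reducedness turns the
    crux into the failure of its own route at every prime; false as soon as `CoverResolutionAt p`
    is known for ONE prime (`kedlayaReduction_false_without_isReduced_of_coverResolutionAt`).
  - (H2) drop `LocallyOfFiniteType f`: same shape (`not_perfectResolutionWithoutFiniteTypeAt`,
    witness `Spec 𝔽_p[X]⁺`, the absolute integral closure of the affine line, tree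
    `not_hasResolution_spec_absoluteIntegralClosure`; `kedlayaReductionWithoutFiniteType_iff`).
  - (H3) drop `PerfectField k` from the CONCLUSION: `KedlayaReductionWithoutPerfect ↔
    DescentPerfectToAll` (crux #4, stmt-0549, open: Temkin 2008 Q 3.3.3) —
    `kedlayaReductionWithoutPerfect_iff_descentPerfectToAll`. (In the PROOF, perfectness is used
    exactly once: Kedlaya's theorem needs `X` geometrically reduced; over an imperfect `k` the
    integral curve `yᵖ = t xᵖ` in `ℙ²_{𝔽_p(t)}` is nowhere smooth and admits no generically étale
    map to `ℙ¹` — not formalised here.)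
  - (H4) `IsSeparated f`, `QuasiCompact f`: no counterexample found or expected (a resolution of a
    non-quasi-compact or non-separated reduced scheme locally of finite type over a perfect field is
    predicted by functorial resolution); they are used by the PROOF (Chow's lemma and projective
    closure in `stub_projectiveIntegralSuffices`). Possibly unnecessary for truth; necessary for
    this proof.
  - (H5) `CharP k p` / universe `0`: bookkeeping only (shared with the summit statement).
* **§3 Degenerate instances** (from the rattack pass, re-read): `CoverResolutionAt p` is inhabited
  non-vacuously at `(X, f) = (ℙⁿ_k, 𝟙)` and at `n = 0` (finite separable field extensions);
  `PerfectResolutionAt p` has no junk-false instance (`X = ∅`, `Spec k` resolve themselves).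
  No small/finite model can bear on the crux: both sides quantify over all dimensions.
* **Barriers / negatives consulted:** `ledger negatives` for the summit (PatchingRel disprover's
  `NonReducedNoResolution`, `AbsoluteIntegralClosureNoResolution` — reused in §2);
  `Literature/Barriers/ResolutionOfSingularities/` (InseparableBaseChange,
  RegularNotGeometricallyRegular bear on (H3)/crux #4, not on this crux).

No `sorry` in this file. No targets (no line picked, `stuck_stubs = []`).
-/

noncomputable section

set_option linter.dupNamespace false -- mandated namespace of this single-conjunct summit

open CategoryTheory AlgebraicGeometry Literature.AlgebraicGeometry.Resolution

namespace Summit.ResolutionOfSingularities.ResolutionOfSingularities.Cruxes.KedlayaReduction.Disproof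

open Summit.ResolutionOfSingularities.ResolutionOfSingularities.Theses.CleanCovers

/-! ## §0 Reformulation: antecedent and conclusion at a fixed prime -/

/-- The antecedent of the crux at `p` = the body of `CleanCovers.CoverResolution` at `p`: every
integral scheme finite surjective over `ℙⁿ_k` (`k` perfect of characteristic `p`), étale over the
chart `D₊(xₙ)`, has a resolution. [folklore] -/
def CoverResolutionAt (p : ℕ) : Prop :=
  ∀ (k : Type) [Field k] [CharP k p] [PerfectField k] (n : ℕ) (X : Scheme.{0})
    (f : X ⟶ (Literature.AlgebraicGeometry.Motives.projectiveSpace n k).left),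
    IsIntegral X → IsFinite f → Function.Surjective f.base →
    (letI := MvPolynomial.gradedAlgebra (σ := Fin (n + 1)) (R := k)
     Etale (f ∣_ (Proj.basicOpen (MvPolynomial.homogeneousSubmodule (Fin (n + 1)) k)
       (MvPolynomial.X (Fin.last n))))) →
    Scheme.HasResolution X

/-- The conclusion of the crux at `p` = resolution of every reduced separated scheme of finite
type over every perfect field of characteristic `p` = the hypothesis of
`CleanCovers.DescentPerfectToAll` at `p`. [folklore] -/
def PerfectResolutionAt (p : ℕ) : Prop :=
  ∀ (k : Type) [Field k] [CharP k p] [PerfectField k] (X : Scheme.{0}) (f : X ⟶ Spec (.of k)),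
    IsSeparated f → LocallyOfFiniteType f → QuasiCompact f → IsReduced X → Scheme.HasResolution X

/-- Read-back of the crux, binder for binder. [folklore] -/
theorem kedlayaReduction_iff :
    KedlayaReduction ↔ ∀ p : ℕ, p.Prime → (CoverResolutionAt p → PerfectResolutionAt p) :=
  Iff.rfl

/-- Read-back of the rank-2 crux. [folklore] -/
theorem coverResolution_iff : CoverResolution ↔ ∀ p : ℕ, p.Prime → CoverResolutionAt p :=
  Iff.rfl

/-- Read-back of the rank-4 crux. [folklore] -/
theorem descentPerfectToAll_iff :
    DescentPerfectToAll ↔ ∀ p : ℕ, p.Prime → (PerfectResolutionAt p → ResolutionInChar.{0} p) :=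
  Iff.rfl

/-! ## §1 Status: the crux is PROVED (so no disproof exists)

The positive statement `KedlayaReduction` itself is a prover's landing (anti-leakage): the
prover-ready 8-line file is attached to the item as evidence `KedlayaReductionHolds.lean`
(this seat) / `Equivalence.lean` (rattack-15104). Here the same argument is recorded pointwise in
`p`, which is all the analysis below needs. -/

/-- **The crux at a prime `p`** (pointwise form of `KedlayaReduction`, PROVED): projective
reduction (`stub_projectiveIntegralSuffices`: irreducible components, Chow, projective closure — it
suffices to resolve integral closed subschemes `Z ⊆ ℙᴺ_k`), then Kedlaya 2005 Thm 1 in the tree's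
proved form (`Kedlaya2004_finite_etale_off_hyperplane_holds`: `Z` integral and finite over `ℙᴺ_k`,
`k` perfect, admits a finite surjective `g : Z → ℙⁿ_k` étale over `D₊(xₙ)`), then the antecedent.
No normalisation is needed. [cite: Kedlaya2004, Thm 1] -/
theorem perfectResolutionAt_of_coverResolutionAt {p : ℕ} (hp : p.Prime)
    (hC : CoverResolutionAt p) : PerfectResolutionAt p := by
  intro k _ _ _ X f hsep hlft hqc hred
  refine Theorems.WeightedThesis.ProjectiveIntegralSuffices.stub_projectiveIntegralSuffices k ?_ X f
    hsep hlft hqc hred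
  intro N Z ι hι hint
  haveI := hι
  obtain ⟨n, g, -, hfin, hsurj, het⟩ :=
    Kedlaya2004_finite_etale_off_hyperplane_holds p hp k N Z ι hint inferInstance
  exact hC k n Z g hint hfin hsurj het

/-- **No refutation of the crux exists** (short of an inconsistency): it is a theorem — stated as
a double negation so that this work file lands no positive route statement. [folklore] -/
theorem not_not_kedlayaReduction : ¬ ¬ KedlayaReduction :=
  fun h => h fun _ hp hC => perfectResolutionAt_of_coverResolutionAt hp hC

/-- The trivial converse of the crux at `p`: an integral scheme finite over `ℙⁿ_k` is a reduced
separated `k`-scheme of finite type (finite and `ℙⁿ_k → Spec k` are proper), so resolution over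
perfect fields of characteristic `p` resolves every Kedlaya cover. [folklore] -/
theorem coverResolutionAt_of_perfectResolutionAt {p : ℕ} (h : PerfectResolutionAt p) :
    CoverResolutionAt p := by
  intro k _ _ _ n X f hint hfin _ _
  haveI := hfin
  haveI : IsProper (Literature.AlgebraicGeometry.Motives.projectiveSpace n k).hom :=
    Literature.AlgebraicGeometry.Motives.isProper_projectiveSpace n k
  haveI : IsProper (f ≫ (Literature.AlgebraicGeometry.Motives.projectiveSpace n k).hom) :=
    inferInstance
  exact h k X (f ≫ (Literature.AlgebraicGeometry.Motives.projectiveSpace n k).hom)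
    inferInstance inferInstance inferInstance inferInstance

/-- **The crux is an equivalence**: at every prime `p`, Kedlaya covers resolve iff all reduced
separated finite-type schemes over perfect fields of characteristic `p` resolve. [folklore] -/
theorem coverResolutionAt_iff_perfectResolutionAt {p : ℕ} (hp : p.Prime) :
    CoverResolutionAt p ↔ PerfectResolutionAt p :=
  ⟨perfectResolutionAt_of_coverResolutionAt hp, coverResolutionAt_of_perfectResolutionAt⟩

/-- Hence the rank-2 crux `CoverResolution` IS resolution over perfect fields in every positive
characteristic (the Kedlaya normal form is lossless). [folklore] -/
theorem coverResolution_iff_perfect : CoverResolution ↔ ∀ p : ℕ, p.Prime → PerfectResolutionAt p :=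
  ⟨fun h p hp => (coverResolutionAt_iff_perfectResolutionAt hp).1 (h p hp),
   fun h p hp => coverResolutionAt_of_perfectResolutionAt (h p hp)⟩

/-! ## §2 Load-bearing hypotheses

Pattern: `KedlayaReductionWithout<H>` is the crux with hypothesis `H` dropped; since the antecedent
is open, the sharpest available statement is an `iff` with a named open statement, plus falsity
modulo `CoverResolutionAt p` at one prime where the dropped conclusion is outright false. -/

/-! ### (H0) the antecedent `CoverResolutionAt p` -/

/-- The crux with its antecedent dropped: resolution over perfect fields in every positive
characteristic. [folklore] -/
def KedlayaReductionWithoutCover : Prop :=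
  ∀ p : ℕ, p.Prime → PerfectResolutionAt p

/-- Dropping the antecedent turns crux #3 into crux #2 (`CoverResolution`, open in dimension
`≥ 4`): any antecedent-free proof of the conclusion IS the summit over perfect fields. [folklore] -/
theorem kedlayaReductionWithoutCover_iff : KedlayaReductionWithoutCover ↔ CoverResolution :=
  coverResolution_iff_perfect.symm

/-- … and it is implied by the summit (restriction to perfect ground fields). [folklore] -/
theorem kedlayaReductionWithoutCover_of_summit (h : _root_.ResolutionOfSingularities) :
    KedlayaReductionWithoutCover :=
  fun p hp k _ _ _ X f hsep hlft hqc hred => h p hp k X f hsep hlft hqc hred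

/-! ### (H1) `IsReduced X` -/

/-- The conclusion at `p` with `IsReduced X` dropped. [folklore] -/
def PerfectResolutionWithoutIsReducedAt (p : ℕ) : Prop :=
  ∀ (k : Type) [Field k] [CharP k p] [PerfectField k] (X : Scheme.{0}) (f : X ⟶ Spec (.of k)),
    IsSeparated f → LocallyOfFiniteType f → QuasiCompact f → Scheme.HasResolution X

/-- **The conclusion without `IsReduced` is false at every prime**: `Spec 𝔽_p[ε] → Spec 𝔽_p` is
affine of finite type over a perfect field and `Spec 𝔽_p[ε]` has no resolution (a dense open of the
one-point space is everything, so the stalk `𝔽_p[ε]` would be regular, hence a domain; tree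
`not_hasResolution_spec_dualNumber`). [folklore] -/
theorem not_perfectResolutionWithoutIsReducedAt (p : ℕ) (hp : p.Prime) :
    ¬ PerfectResolutionWithoutIsReducedAt p := by
  haveI : Fact p.Prime := ⟨hp⟩
  intro h
  haveI : Module.Finite (ZMod p) (DualNumber (ZMod p)) :=
    inferInstanceAs (Module.Finite (ZMod p) (ZMod p × ZMod p))
  let f : Spec (.of (DualNumber (ZMod p))) ⟶ Spec (.of (ZMod p)) :=
    Spec.map (CommRingCat.ofHom (algebraMap (ZMod p) (DualNumber (ZMod p))))
  haveI : LocallyOfFiniteType f :=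
    (HasRingHomProperty.Spec_iff (P := @LocallyOfFiniteType)).mpr
      (RingHom.finiteType_algebraMap.mpr inferInstance)
  exact not_hasResolution_spec_dualNumber (ZMod p)
    (h (ZMod p) (Spec (.of (DualNumber (ZMod p)))) f inferInstance inferInstance inferInstance)

/-- The crux with `IsReduced X` dropped from its conclusion. [folklore] -/
def KedlayaReductionWithoutIsReduced : Prop :=
  ∀ p : ℕ, p.Prime → (CoverResolutionAt p → PerfectResolutionWithoutIsReducedAt p)

/-- **Dropping `IsReduced` turns the crux into the failure of its own route at every prime.**
[folklore] -/
theorem kedlayaReductionWithoutIsReduced_iff :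
    KedlayaReductionWithoutIsReduced ↔ ∀ p : ℕ, p.Prime → ¬ CoverResolutionAt p :=
  ⟨fun h p hp hC => not_perfectResolutionWithoutIsReducedAt p hp (h p hp hC),
   fun h p hp hC => absurd hC (h p hp)⟩

/-- Equivalently (by §1): into the failure of resolution over perfect fields in EVERY positive
characteristic — believed false, not refutable today (all dimensions are quantified). [folklore] -/
theorem kedlayaReductionWithoutIsReduced_iff' :
    KedlayaReductionWithoutIsReduced ↔ ∀ p : ℕ, p.Prime → ¬ PerfectResolutionAt p := by
  rw [kedlayaReductionWithoutIsReduced_iff]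
  exact forall₂_congr fun p hp => not_congr (coverResolutionAt_iff_perfectResolutionAt hp)

/-- `IsReduced` is load-bearing: the `IsReduced`-free crux is false as soon as Kedlaya covers
resolve at ONE prime (e.g. it would already contradict `CoverResolution`). [folklore] -/
theorem kedlayaReduction_false_without_isReduced_of_coverResolutionAt {p : ℕ} (hp : p.Prime)
    (hC : CoverResolutionAt p) : ¬ KedlayaReductionWithoutIsReduced :=
  fun h => kedlayaReductionWithoutIsReduced_iff.1 h p hp hC

/-- In particular the `IsReduced`-free crux refutes the route's rank-2 crux. [folklore] -/
theorem not_coverResolution_of_kedlayaReductionWithoutIsReduced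
    (h : KedlayaReductionWithoutIsReduced) : ¬ CoverResolution :=
  fun hC => kedlayaReductionWithoutIsReduced_iff.1 h 2 Nat.prime_two (hC 2 Nat.prime_two)

/-! ### (H2) `LocallyOfFiniteType f` -/

/-- The conclusion at `p` with `LocallyOfFiniteType f` dropped. [folklore] -/
def PerfectResolutionWithoutFiniteTypeAt (p : ℕ) : Prop :=
  ∀ (k : Type) [Field k] [CharP k p] [PerfectField k] (X : Scheme.{0}) (f : X ⟶ Spec (.of k)),
    IsSeparated f → QuasiCompact f → IsReduced X → Scheme.HasResolution X

open Polynomial in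
/-- **The conclusion without `LocallyOfFiniteType` is false at every prime**: `Spec 𝔽_p[X]⁺ → Spec 𝔽_p`
(absolute integral closure of the affine line: affine, reduced) has no resolution — every
non-generic stalk of a root-closed domain is non-Noetherian (tree
`not_hasResolution_spec_absoluteIntegralClosure`). [folklore] -/
theorem not_perfectResolutionWithoutFiniteTypeAt (p : ℕ) (hp : p.Prime) :
    ¬ PerfectResolutionWithoutFiniteTypeAt p := by
  haveI : Fact p.Prime := ⟨hp⟩
  intro h
  let f : Spec (.of ↥(integralClosure (ZMod p)[X] (AlgebraicClosure (RatFunc (ZMod p))))) ⟶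
      Spec (.of (ZMod p)) :=
    Spec.map (CommRingCat.ofHom ((algebraMap (ZMod p)[X]
      ↥(integralClosure (ZMod p)[X] (AlgebraicClosure (RatFunc (ZMod p))))).comp Polynomial.C))
  exact not_hasResolution_spec_absoluteIntegralClosure p
    (h (ZMod p) _ f inferInstance inferInstance inferInstance)

/-- The crux with `LocallyOfFiniteType f` dropped from its conclusion. [folklore] -/
def KedlayaReductionWithoutFiniteType : Prop :=
  ∀ p : ℕ, p.Prime → (CoverResolutionAt p → PerfectResolutionWithoutFiniteTypeAt p)

/-- **Dropping finite type turns the crux into the failure of its own route at every prime.**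
[folklore] -/
theorem kedlayaReductionWithoutFiniteType_iff :
    KedlayaReductionWithoutFiniteType ↔ ∀ p : ℕ, p.Prime → ¬ CoverResolutionAt p :=
  ⟨fun h p hp hC => not_perfectResolutionWithoutFiniteTypeAt p hp (h p hp hC),
   fun h p hp hC => absurd hC (h p hp)⟩

/-- `LocallyOfFiniteType` is load-bearing: the finite-type-free crux is false as soon as Kedlaya
covers resolve at ONE prime. [folklore] -/
theorem kedlayaReduction_false_without_finiteType_of_coverResolutionAt {p : ℕ} (hp : p.Prime)
    (hC : CoverResolutionAt p) : ¬ KedlayaReductionWithoutFiniteType :=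
  fun h => kedlayaReductionWithoutFiniteType_iff.1 h p hp hC

/-- The two droppings are indistinguishable at the level of provability today: both are
equivalent to `∀ p prime, ¬ CoverResolutionAt p`. [folklore] -/
theorem kedlayaReductionWithoutFiniteType_iff_withoutIsReduced :
    KedlayaReductionWithoutFiniteType ↔ KedlayaReductionWithoutIsReduced :=
  kedlayaReductionWithoutFiniteType_iff.trans kedlayaReductionWithoutIsReduced_iff.symm

/-! ### (H3) `PerfectField k` in the conclusion -/

/-- The crux with `PerfectField k` dropped from its CONCLUSION (kept in the antecedent): Kedlaya
covers over perfect fields of characteristic `p` resolve ⇒ resolution over ALL fields of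
characteristic `p`. [folklore] -/
def KedlayaReductionWithoutPerfect : Prop :=
  ∀ p : ℕ, p.Prime → (CoverResolutionAt p → ResolutionInChar.{0} p)

/-- **Dropping `PerfectField` from the conclusion turns crux #3 into crux #4**
(`DescentPerfectToAll`, stmt-0549: descent of resolution from perfect to arbitrary ground fields,
open — regular is not geometrically regular under inseparable extension). So the perfectness
hypothesis of the conclusion is exactly as necessary as the descent problem is hard. [folklore] -/
theorem kedlayaReductionWithoutPerfect_iff_descentPerfectToAll :
    KedlayaReductionWithoutPerfect ↔ DescentPerfectToAll :=
  forall₂_congr fun _ hp =>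
    Iff.imp (coverResolutionAt_iff_perfectResolutionAt hp) Iff.rfl

/-- … and the `PerfectField`-free crux together with `CoverResolution` is already the summit
(the route would need no descent item). [folklore] -/
theorem summit_of_kedlayaReductionWithoutPerfect (h : KedlayaReductionWithoutPerfect)
    (hC : CoverResolution) : _root_.ResolutionOfSingularities :=
  fun p hp => h p hp (hC p hp)

end Summit.ResolutionOfSingularities.ResolutionOfSingularities.Cruxes.KedlayaReduction.Disproof

end
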